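import Literature.Probability.RandomPlanarGeometry.HexSAWBrickWallStripWidthOneAmplitude
import Literature.Probability.RandomPlanarGeometry.HexSAWBrickWallStripMargin
import Mathlib.Tactic
import HarnessLib

/-!
# The amplitude of the one-cell honeycomb strip with an explicit, LINEAR error term:
# `|c_N(S_1) − A·μ(S_1)^N| ≤ 20·N` for every `N ≥ 2`

Topic `Literature/Probability/RandomPlanarGeometry` (continues `HexSAWBrickWallStripWidthOneAmplitude.lean`:
`c_N(S_1)/μ^N → A = (1524 + 2716μ + 2728μ²)/575`, `μ = μ(S_1)` the plastic number, via the closed form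
`25·c_N = u_N − ε(N)` of `HexSAWBrickWallStripWidthOneSeries.lean` (`u = plast`, `ε = corr ≤ 336 + 55N`), the projection
`padovan_proj` and the EXACT energy identity `padovan_energy` for the deflated sequence `e_n = u_{n+1} − μu_n`).

The limit statement hides how small the error is.  Since `(3μ² − 1)u_N = d₀μ^N − 2μe_N − e_{N+1}` EXACTLY and the energy
`Q_n = e_{n+1}² + μe_{n+1}e_n + (μ²−1)e_n² = (μ² − 1)ⁿQ₀` is positive definite (`Q_n ≥ (¾μ² − 1)e_n²`), the deflated sequence
is uniformly bounded — here crudely `|e_n| ≤ 110` for all `n` — so the only non-negligible correction to `A·μ^N` is the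
quasi-polynomial `ε(N)/25 ≤ (336 + 55N)/25`:

  ★★ `abs_stripCount_one_sub_amplitude_mul_pow_le`: `|c_N(S_1) − A·μ(S_1)^N| ≤ 20·N` for all `N ≥ 2` — the error in the
     COUNT is linear in `N` while the count grows like `17.23·1.3247^N`;
  ★ `abs_stripCount_one_div_pow_sub_amplitude_le`: `|c_N(S_1)/μ^N − A| ≤ 20·N/μ^N` (`N ≥ 2`), an explicit exponential rate;
  ★ `abs_stripCount_one_ratio_sub_le`: `|c_{N+1}(S_1)/c_N(S_1) − μ| ≤ 60·N/μ^N` (`N ≥ 2`) — an explicit rate for the ratio law;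
  `abs_plast_defl_le` (`|u_{n+1} − μu_n| ≤ 110`), `plast_proj_eq` (`(3μ²−1)u_n = d₀μⁿ − 2μe_n − e_{n+1}`, `d₀ = 288 + 592μ + 436μ²`).

Sources: N. Madras, G. Slade, *The Self-Avoiding Walk* (1993), §1.1 eq. (1.1.4) p. 5 (`c_N ∼ Aμ^N N^{γ−1}`), §8.5 Notes
pp. 278–279 (`γ(R) = 1` for one-dimensional lattices: Klein 1980, Alm–Janson 1990); R. P. Stanley, *Enumerative
Combinatorics* 1 (2nd ed.), §4.1 Theorem 4.1.1 (iii) (exponential–polynomial form of the coefficients).  The explicit error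
bound is not in print; it is derived here from the tree's closed form.

## Statements (namespace `Literature.Probability.RandomPlanarGeometry.SAW.HexBW.WidthOne`, all PROVED, standard axioms)
`plast_proj_eq`, `abs_plast_defl_le`, ★★ `abs_stripCount_one_sub_amplitude_mul_pow_le`, ★ `abs_stripCount_one_div_pow_sub_amplitude_le`,
★ `abs_stripCount_one_ratio_sub_le`.
-/

noncomputable section

open Filter Topology

namespace Literature.Probability.RandomPlanarGeometry.SAW.HexBW

namespace WidthOne

section rate

/-- The exact projection identity for `u = plast`: `(3μ² − 1)u_n = d₀μⁿ − 2μ(u_{n+1} − μu_n) − (u_{n+2} − μu_{n+1})` with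
`d₀ = 288 + 592μ + 436μ²`, for every real `μ` with `μ³ = μ + 1`. [cite: Stanley2012EC1, §4.1 (Theorem 4.1.1 (iii))] -/
theorem plast_proj_eq {μ : ℝ} (hμ : μ ^ 3 = μ + 1) (n : ℕ) :
    (3 * μ ^ 2 - 1) * (plast n : ℝ) = (288 + 592 * μ + 436 * μ ^ 2) * μ ^ n
      - 2 * μ * ((plast (n + 1) : ℝ) - μ * (plast n : ℝ)) - ((plast (n + 2) : ℝ) - μ * (plast (n + 1) : ℝ)) := by
  have h := padovan_proj hμ (u := fun n => (plast n : ℝ)) plast_rec_real n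
  have e : ((plast 2 : ℤ) : ℝ) + μ * ((plast 1 : ℤ) : ℝ) + (μ ^ 2 - 1) * ((plast 0 : ℤ) : ℝ)
      = 288 + 592 * μ + 436 * μ ^ 2 := by
    simp only [plast]; push_cast; ring
  rw [e] at h
  linear_combination h

/-- The deflated plastic sequence is uniformly bounded: `|u_{n+1} − μ(S_1)·u_n| ≤ 110` for all `n` (crude but explicit:
`Q₀ ≤ 3800`, `¾μ² − 1 ≥ 0.316`, `(μ²−1)ⁿ ≤ 1`). [cite: Stanley2012EC1, §4.1 (Theorem 4.1.1 (iii))] -/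
theorem abs_plast_defl_le (n : ℕ) :
    |(plast (n + 1) : ℝ) - stripConnectiveConstant 1 * (plast n : ℝ)| ≤ 110 := by
  set μ := stripConnectiveConstant 1 with hμdef
  obtain ⟨hlo, hhi⟩ := stripConnectiveConstant_one_mem_Ioo
  rw [← hμdef] at hlo hhi
  have hc : μ ^ 3 = μ + 1 := stripConnectiveConstant_one_pow_three
  have hμ2 : 1.7548 < μ ^ 2 := by nlinarith only [hlo, sq_nonneg (μ - 1.3247)]
  have hμ2' : μ ^ 2 < 1.7551 := by nlinarith only [hlo, hhi]
  -- numeric bounds on `e_0 = 592 − 436μ`, `e_1 = 724 − 592μ` and on `Q₀ ≤ 3800`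
  have he1 : (724 : ℝ) - μ * 592 < -60.2 := by linarith only [hlo]
  have he1' : -60.3 < (724 : ℝ) - μ * 592 := by linarith only [hhi]
  have he0 : (592 : ℝ) - μ * 436 < 14.44 := by linarith only [hlo]
  have he0' : 14.38 < (592 : ℝ) - μ * 436 := by linarith only [hhi]
  have he1sq : ((724 : ℝ) - μ * 592) ^ 2 ≤ 60.3 ^ 2 := by
    nlinarith only [he1, he1']
  have he0sq : ((592 : ℝ) - μ * 436) ^ 2 ≤ 14.44 ^ 2 := by
    nlinarith only [he0, he0']
  have hneg : μ * (724 - μ * 592) * (592 - μ * 436) ≤ 0 := by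
    have h1 : (724 - μ * 592) * (592 - μ * 436) < 0 := mul_neg_of_neg_of_pos (by linarith) (by linarith)
    nlinarith only [h1, hlo]
  have hlast : (μ ^ 2 - 1) * ((592 : ℝ) - μ * 436) ^ 2 ≤ 0.7551 * 14.44 ^ 2 := by
    have h1 : (0 : ℝ) ≤ μ ^ 2 - 1 := by linarith only [hμ2]
    have h2 : μ ^ 2 - 1 ≤ 0.7551 := by linarith only [hμ2']
    calc (μ ^ 2 - 1) * ((592 : ℝ) - μ * 436) ^ 2 ≤ (μ ^ 2 - 1) * 14.44 ^ 2 :=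
          mul_le_mul_of_nonneg_left he0sq h1
      _ ≤ 0.7551 * 14.44 ^ 2 := mul_le_mul_of_nonneg_right h2 (by norm_num)
  have hQ0 : ((724 : ℝ) - μ * 592) ^ 2 + μ * (724 - μ * 592) * (592 - μ * 436) + (μ ^ 2 - 1) * (592 - μ * 436) ^ 2
      ≤ 3800 := by
    linarith only [he1sq, hneg, hlast]
  -- the energy identity and positive definiteness: `(¾μ² − 1)·e_n² ≤ Q_n = (μ²−1)ⁿ Q₀ ≤ Q₀`
  have hE := padovan_energy hc (u := fun n => (plast n : ℝ)) plast_rec_real n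
  simp only [plast] at hE
  push_cast at hE
  set a := (plast (n + 2) : ℝ) - μ * (plast (n + 1) : ℝ) with ha
  set b := (plast (n + 1) : ℝ) - μ * (plast n : ℝ) with hb
  have hq0 : (0 : ℝ) ≤ (μ ^ 2 - 1) ^ n := pow_nonneg (by linarith only [hμ2]) n
  have hq1 : (μ ^ 2 - 1) ^ n ≤ 1 := pow_le_one₀ (by linarith only [hμ2]) (by linarith only [hμ2'])
  have hQn : (3 / 4 * μ ^ 2 - 1) * b ^ 2 ≤ a ^ 2 + μ * a * b + (μ ^ 2 - 1) * b ^ 2 := by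
    nlinarith only [sq_nonneg (a + μ * b / 2)]
  have hκ : (0.316 : ℝ) ≤ 3 / 4 * μ ^ 2 - 1 := by linarith only [hμ2]
  have hQle : a ^ 2 + μ * a * b + (μ ^ 2 - 1) * b ^ 2 ≤ 3800 := by
    rw [hE]
    calc (μ ^ 2 - 1) ^ n * (((724 : ℝ) - μ * 592) ^ 2 + μ * (724 - μ * 592) * (592 - μ * 436)
          + (μ ^ 2 - 1) * (592 - μ * 436) ^ 2)
        ≤ (μ ^ 2 - 1) ^ n * 3800 := mul_le_mul_of_nonneg_left hQ0 hq0
      _ ≤ 1 * 3800 := mul_le_mul_of_nonneg_right hq1 (by norm_num)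
      _ = 3800 := one_mul _
  have hb2 : b ^ 2 ≤ 110 ^ 2 := by
    have h1 : 0.316 * b ^ 2 ≤ 3800 :=
      calc 0.316 * b ^ 2 ≤ (3 / 4 * μ ^ 2 - 1) * b ^ 2 := mul_le_mul_of_nonneg_right hκ (sq_nonneg b)
        _ ≤ 3800 := hQn.trans hQle
    linarith only [h1]
  exact abs_le.2 (abs_le_of_sq_le_sq' hb2 (by norm_num))

/-- ★★ **Linear error term.** For every `N ≥ 2`: `|c_N(S_1) − A·μ(S_1)^N| ≤ 20·N`, `A = (1524 + 2716μ + 2728μ²)/575`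
(`c_N = A·μ^N − ε(N)/25 + O(1)` with `0 ≤ ε(N) ≤ 336 + 55N` the explicit quasi-polynomial of the closed form and the `O(1)`
at most `4`). [cite: MadrasSlade1993, §1.1 eq. (1.1.4) p. 5 (c_N ∼ Aμ^N N^{γ−1}), §8.5 Notes pp. 278–279 (γ(R) = 1); Stanley2012EC1, §4.1 (Theorem 4.1.1 (iii))] -/
theorem abs_stripCount_one_sub_amplitude_mul_pow_le (N : ℕ) (hN : 2 ≤ N) :
    |(stripCount 1 N : ℝ) - (1524 + 2716 * stripConnectiveConstant 1 + 2728 * stripConnectiveConstant 1 ^ 2) / 575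
        * stripConnectiveConstant 1 ^ N| ≤ 20 * (N : ℝ) := by
  set μ := stripConnectiveConstant 1 with hμdef
  obtain ⟨hlo, hhi⟩ := stripConnectiveConstant_one_mem_Ioo
  rw [← hμdef] at hlo hhi
  have hc : μ ^ 3 = μ + 1 := stripConnectiveConstant_one_pow_three
  have h1 : 1 < μ := by linarith
  -- the closed form and the projection identity
  have hcf : (25 : ℝ) * (stripCount 1 N : ℝ) = (plast N : ℝ) - (corr N : ℝ) := by
    exact_mod_cast stripCount_one_closed_form N hN
  have hproj := plast_proj_eq hc N
  have hA : (288 + 592 * μ + 436 * μ ^ 2) / (25 * (3 * μ ^ 2 - 1)) = (1524 + 2716 * μ + 2728 * μ ^ 2) / 575 :=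
    amplitude_residue_eq_norm hc h1
  have hD : 0 < 3 * μ ^ 2 - 1 := by nlinarith
  -- bounds
  have heN := abs_plast_defl_le N
  have heN1 := abs_plast_defl_le (N + 1)
  rw [← hμdef] at heN heN1
  have hε0 : (0 : ℝ) ≤ (corr N : ℝ) := by exact_mod_cast corr_nonneg N
  have hε1 : (corr N : ℝ) ≤ 336 + 55 * N := by exact_mod_cast corr_le N
  have hN2 : (2 : ℝ) ≤ N := by exact_mod_cast hN
  -- `25(3μ²−1)(c_N − Aμ^N) = −2μ e_N − e_{N+1} − (3μ²−1) ε(N)`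
  have hA' : (1524 + 2716 * μ + 2728 * μ ^ 2) / 575 * (25 * (3 * μ ^ 2 - 1)) = 288 + 592 * μ + 436 * μ ^ 2 := by
    rw [← hA, div_mul_cancel₀ _ (by positivity)]
  have key : 25 * (3 * μ ^ 2 - 1) * ((stripCount 1 N : ℝ) - (1524 + 2716 * μ + 2728 * μ ^ 2) / 575 * μ ^ N)
      = -(2 * μ * ((plast (N + 1) : ℝ) - μ * (plast N : ℝ))) - ((plast (N + 2) : ℝ) - μ * (plast (N + 1) : ℝ))
        - (3 * μ ^ 2 - 1) * (corr N : ℝ) := by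
    calc 25 * (3 * μ ^ 2 - 1) * ((stripCount 1 N : ℝ) - (1524 + 2716 * μ + 2728 * μ ^ 2) / 575 * μ ^ N)
        = (3 * μ ^ 2 - 1) * (25 * (stripCount 1 N : ℝ))
          - (1524 + 2716 * μ + 2728 * μ ^ 2) / 575 * (25 * (3 * μ ^ 2 - 1)) * μ ^ N := by ring
      _ = (3 * μ ^ 2 - 1) * ((plast N : ℝ) - (corr N : ℝ)) - (288 + 592 * μ + 436 * μ ^ 2) * μ ^ N := by
          rw [hcf, hA']
      _ = _ := by linear_combination hproj
  have habs : |25 * (3 * μ ^ 2 - 1) * ((stripCount 1 N : ℝ) - (1524 + 2716 * μ + 2728 * μ ^ 2) / 575 * μ ^ N)|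
      ≤ 2 * μ * 110 + 110 + (3 * μ ^ 2 - 1) * (336 + 55 * N) := by
    rw [key]
    have h2 : |2 * μ * ((plast (N + 1) : ℝ) - μ * (plast N : ℝ))| ≤ 2 * μ * 110 := by
      rw [abs_mul, abs_of_pos (by linarith : (0 : ℝ) < 2 * μ)]
      exact mul_le_mul_of_nonneg_left heN (by linarith)
    have h3 : |(3 * μ ^ 2 - 1) * (corr N : ℝ)| ≤ (3 * μ ^ 2 - 1) * (336 + 55 * N) := by
      rw [abs_mul, abs_of_pos hD, abs_of_nonneg hε0]
      exact mul_le_mul_of_nonneg_left hε1 hD.le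
    calc |-(2 * μ * ((plast (N + 1) : ℝ) - μ * (plast N : ℝ))) - ((plast (N + 2) : ℝ) - μ * (plast (N + 1) : ℝ))
          - (3 * μ ^ 2 - 1) * (corr N : ℝ)|
        ≤ |-(2 * μ * ((plast (N + 1) : ℝ) - μ * (plast N : ℝ))) - ((plast (N + 2) : ℝ) - μ * (plast (N + 1) : ℝ))|
          + |(3 * μ ^ 2 - 1) * (corr N : ℝ)| := abs_sub _ _
      _ ≤ (|2 * μ * ((plast (N + 1) : ℝ) - μ * (plast N : ℝ))| + |(plast (N + 2) : ℝ) - μ * (plast (N + 1) : ℝ)|)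
          + |(3 * μ ^ 2 - 1) * (corr N : ℝ)| := by
          gcongr
          calc _ ≤ |-(2 * μ * ((plast (N + 1) : ℝ) - μ * (plast N : ℝ)))| + |(plast (N + 2) : ℝ) - μ * (plast (N + 1) : ℝ)| :=
                abs_sub _ _
            _ = _ := by rw [abs_neg]
      _ ≤ (2 * μ * 110 + 110) + (3 * μ ^ 2 - 1) * (336 + 55 * N) := by linarith
  -- divide by `25(3μ²−1)`
  have hpos : (0 : ℝ) < 25 * (3 * μ ^ 2 - 1) := by positivity
  rw [abs_mul, abs_of_pos hpos] at habs
  have hμ2 : 1.7548 < μ ^ 2 := by nlinarith only [hlo, sq_nonneg (μ - 1.3247)]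
  have h3 : (0 : ℝ) ≤ 3 * μ ^ 2 - 1 - 4.2644 := by linarith only [hμ2]
  have h4 : (0 : ℝ) ≤ (N : ℝ) - 2 := by linarith only [hN2]
  have hR : 2 * μ * 110 + 110 + (3 * μ ^ 2 - 1) * (336 + 55 * N) ≤ 25 * (3 * μ ^ 2 - 1) * (20 * (N : ℝ)) := by
    nlinarith only [h3, h4, hhi, mul_nonneg h3 h4]
  exact le_of_mul_le_mul_left (habs.trans hR) hpos

/-- ★ **Explicit exponential rate for the normalised counts**: `|c_N(S_1)/μ(S_1)^N − A| ≤ 20·N/μ(S_1)^N` for `N ≥ 2`.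
[cite: MadrasSlade1993, §1.1 eq. (1.1.4) p. 5, §8.5 Notes pp. 278–279 (γ(R) = 1); Stanley2012EC1, §4.1 (Theorem 4.1.1 (iii))] -/
theorem abs_stripCount_one_div_pow_sub_amplitude_le (N : ℕ) (hN : 2 ≤ N) :
    |(stripCount 1 N : ℝ) / stripConnectiveConstant 1 ^ N
        - (1524 + 2716 * stripConnectiveConstant 1 + 2728 * stripConnectiveConstant 1 ^ 2) / 575|
      ≤ 20 * (N : ℝ) / stripConnectiveConstant 1 ^ N := by
  set μ := stripConnectiveConstant 1 with hμdef
  have hμ0 : 0 < μ := by have h := stripConnectiveConstant_one_mem_Ioo.1; rw [← hμdef] at h; linarith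
  have hμN : 0 < μ ^ N := pow_pos hμ0 N
  have h := abs_stripCount_one_sub_amplitude_mul_pow_le N hN
  rw [← hμdef] at h
  rw [le_div_iff₀ hμN]
  have e : ((stripCount 1 N : ℝ) / μ ^ N - (1524 + 2716 * μ + 2728 * μ ^ 2) / 575) * μ ^ N
      = (stripCount 1 N : ℝ) - (1524 + 2716 * μ + 2728 * μ ^ 2) / 575 * μ ^ N := by
    field_simp
  calc |(stripCount 1 N : ℝ) / μ ^ N - (1524 + 2716 * μ + 2728 * μ ^ 2) / 575| * μ ^ N
      = |((stripCount 1 N : ℝ) / μ ^ N - (1524 + 2716 * μ + 2728 * μ ^ 2) / 575) * μ ^ N| := by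
        rw [abs_mul, abs_of_pos hμN]
    _ = _ := by rw [e]
    _ ≤ 20 * (N : ℝ) := h


/-- ★ **Explicit rate for the ratio law**: `|c_{N+1}(S_1)/c_N(S_1) − μ(S_1)| ≤ 60·N/μ(S_1)^N` for every `N ≥ 2`
(from the linear error term twice and Fekete's `μ^N ≤ c_N`, (8.2.3)). [cite: MadrasSlade1993, §8.2 p. 267 eq. (8.2.3), §8.5 Notes pp. 278–279 (γ(R) = 1); Stanley2012EC1, §4.1 (Theorem 4.1.1 (iii))] -/
theorem abs_stripCount_one_ratio_sub_le (N : ℕ) (hN : 2 ≤ N) :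
    |(stripCount 1 (N + 1) : ℝ) / stripCount 1 N - stripConnectiveConstant 1|
      ≤ 60 * (N : ℝ) / stripConnectiveConstant 1 ^ N := by
  set μ := stripConnectiveConstant 1 with hμdef
  obtain ⟨hlo, hhi⟩ := stripConnectiveConstant_one_mem_Ioo
  rw [← hμdef] at hlo hhi
  have hμ0 : 0 < μ := by linarith
  have hμN : 0 < μ ^ N := pow_pos hμ0 N
  have hcN : μ ^ N ≤ (stripCount 1 N : ℝ) := pow_stripConnectiveConstant_le_stripCount 1 N
  have hc0 : 0 < (stripCount 1 N : ℝ) := lt_of_lt_of_le hμN hcN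
  have h0 := abs_stripCount_one_sub_amplitude_mul_pow_le N hN
  have h1 := abs_stripCount_one_sub_amplitude_mul_pow_le (N + 1) (by omega)
  rw [← hμdef] at h0 h1
  set A : ℝ := (1524 + 2716 * μ + 2728 * μ ^ 2) / 575 with hA
  -- `|c_{N+1} − μ c_N| ≤ 20(N+1) + 20 μ N ≤ 60 N`
  have hdiff : |(stripCount 1 (N + 1) : ℝ) - μ * stripCount 1 N| ≤ 60 * N := by
    have e : (stripCount 1 (N + 1) : ℝ) - μ * stripCount 1 N
        = ((stripCount 1 (N + 1) : ℝ) - A * μ ^ (N + 1)) - μ * ((stripCount 1 N : ℝ) - A * μ ^ N) := by ring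
    rw [e]
    have hN2 : (2 : ℝ) ≤ N := by exact_mod_cast hN
    calc |((stripCount 1 (N + 1) : ℝ) - A * μ ^ (N + 1)) - μ * ((stripCount 1 N : ℝ) - A * μ ^ N)|
        ≤ |(stripCount 1 (N + 1) : ℝ) - A * μ ^ (N + 1)| + |μ * ((stripCount 1 N : ℝ) - A * μ ^ N)| := abs_sub _ _
      _ ≤ 20 * ((N + 1 : ℕ) : ℝ) + μ * (20 * N) := by
          rw [abs_mul, abs_of_pos hμ0]
          exact add_le_add h1 (mul_le_mul_of_nonneg_left h0 hμ0.le)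
      _ ≤ 60 * N := by push_cast; nlinarith
  rw [le_div_iff₀ hμN]
  have e2 : ((stripCount 1 (N + 1) : ℝ) / stripCount 1 N - μ) * stripCount 1 N
      = (stripCount 1 (N + 1) : ℝ) - μ * stripCount 1 N := by
    field_simp
  calc |(stripCount 1 (N + 1) : ℝ) / stripCount 1 N - μ| * μ ^ N
      ≤ |(stripCount 1 (N + 1) : ℝ) / stripCount 1 N - μ| * stripCount 1 N :=
        mul_le_mul_of_nonneg_left hcN (abs_nonneg _)
    _ = |((stripCount 1 (N + 1) : ℝ) / stripCount 1 N - μ) * stripCount 1 N| := by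
        rw [abs_mul, abs_of_pos hc0]
    _ = |(stripCount 1 (N + 1) : ℝ) - μ * stripCount 1 N| := by rw [e2]
    _ ≤ 60 * N := hdiff

end rate

end WidthOne

end Literature.Probability.RandomPlanarGeometry.SAW.HexBW
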